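import Literature.NumberTheory.Automorphic.HilbertRepCompactFiniteType
import Literature.NumberTheory.Automorphic.HilbertRepFiniteTypeIdempotent
import HarnessLib

/-!
# The quaternion-side type datum of the trace comparison for a group compact modulo the centre
(Gelbart, *Automorphic forms on adele groups* (1975), §10, p. 151 and p. 153: the `K'_v`-finite
unit vectors `u'_v` of `π'_v`, `v ∈ S`, and the idempotent `R'(ξ'_S)`)

Topic `NumberTheory/Automorphic`; theorems only (no definition, no named fact, no instance). End of
the quaternion-side chain `HilbertRepMinimalIdempotent` → `HilbertRepFiniteTypeIdempotent` →
`HilbertRepCompactFiniteType` of the inline (D-0026) decomposition of the named fact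
`Literature.NumberTheory.Automorphic.multiplicity_one_quaternionUnits` (Gelbart Thm. 10.10): the
hypotheses on `E₂` and the non-zero `E₂`-fixed vector in the constituent `W₁` asked by
`multiplicity_one_quaternionUnits_of_testFamily` (`QuaternionUnitsMultiplicityOneOfTestFamily`) are
produced from group-theoretic data of `G'_S = ∏_{v ∈ S} D_v^×` alone:

* `ContRepresentation.ClosedSubrep.exists_apply_eq_smul_of_mem_center` — central elements of `Γ`
  act by scalars on an irreducible closed invariant subspace of a unitary representation (Schur).
* `ContRepresentation.ClosedSubrep.exists_minimalIdempotent_of_compactModCenter` — for a unitary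
  `τ` of `Γ`, an irreducible closed invariant `W`, `j : K → Γ`, a compact totally disconnected
  group `K₀ → K` (the unit group `𝒪_{D_S}^×`) along which `τ ∘ j` is strongly continuous, a subset
  `Z ⊆ K` mapped into the centre of `Γ` (`K_S^×`) and a finite non-empty `T ⊆ K` with
  `K · T ⊆ T · K₀ · Z` (finite index of `𝒪_{D_S}^× K_S^×` in `D_S^×`), there are a self-adjoint
  idempotent `E` in the bicommutant of `τ(Γ)`, commuting with the centraliser of `j(K)`, acting by
  `E τ(j k) y = c(k) y` on fixed vectors, and a non-zero `E`-fixed vector in `W`.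

## References

* S. Gelbart, *Automorphic forms on adele groups*, Ann. of Math. Studies 83 (1975), §10,
  pp. 151–153 [Gelbart1975].
* A. Deitmar, S. Echterhoff, *Principles of harmonic analysis*, 2nd ed. (2014), Lemma 6.1.7
  [DeitmarEchterhoff2014].
-/

noncomputable section

open MeasureTheory
open scoped InnerProductSpace

namespace ContRepresentation

section CompactModCenter

variable {Γ K : Type*} [Group Γ] [Group K]
  {H : Type*} [NormedAddCommGroup H] [InnerProductSpace ℂ H] [CompleteSpace H]

/-- **Central elements act by scalars on irreducible constituents** (Schur's lemma,
`IsTopIrreducible.exists_apply_eq_smul_of_commute`, for the restriction of `τ(z)` to `W`).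
[cite: DeitmarEchterhoff2014, Lemma 6.1.7] -/
theorem ClosedSubrep.exists_apply_eq_smul_of_mem_center {τ : ContRepresentation ℂ Γ H}
    (hτ : τ.IsUnitary) {W : ClosedSubrep τ} (hW : W.toContRep.IsTopIrreducible) {z : Γ}
    (hz : z ∈ Subgroup.center Γ) : ∃ c : ℂ, ∀ w ∈ W, τ z w = c • w := by
  obtain ⟨c, hc⟩ := hW.exists_apply_eq_smul_of_commute (hτ.toContRep W) (T := W.toContRep z)
    fun g => by
      change W.toContRep g * W.toContRep z = W.toContRep z * W.toContRep g
      rw [← map_mul, ← map_mul, (Subgroup.mem_center_iff.1 hz g)]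
  exact ⟨c, fun w hw => by
    have h := congrArg Subtype.val (hc ⟨w, hw⟩)
    exact h⟩

variable {K₀ : Type*} [TopologicalSpace K₀] [Group K₀] [IsTopologicalGroup K₀] [MeasurableSpace K₀]
  [BorelSpace K₀] [CompactSpace K₀] [TotallyDisconnectedSpace K₀] [T1Space K₀]

/-- **The quaternion-side type datum of the trace comparison, for a group compact modulo the
centre with a profinite open kernel** (Gelbart (1975), §10, p. 151: "we fix a `K'_v`-finite unit
vector `u'_v` in the space of `π'_v`", and the idempotent `R'(ξ'_S)` of p. 153; here
`K = G'_S = ∏_{v ∈ S} D_v^×`, `K₀ = ∏_{v ∈ S} 𝒪_{D_v}^×`). Let `τ` be a unitary representation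
of `Γ`, `W` an irreducible closed invariant subspace, `j : K → Γ`, `i₀ : K₀ → K` a homomorphism
from a compact totally disconnected group along which `τ ∘ j` is strongly continuous (with a left
invariant measure on `K₀` positive on opens, finite on compacts), `Z ⊆ K` mapped into the centre
of `Γ`, and `T ⊆ K` a finite non-empty set with `K · T ⊆ T · i₀(K₀) · Z` elementwise (finite index
of `𝒪_{D_S}^× K_S^×` in `D_S^×`). Then there are a bounded operator `E` and `c : K → ℂ` such
that `E` is a self-adjoint idempotent commuting with the commutant of `τ(Γ)` and with `τ(γ)` for
`γ` centralising `j(K)`, `E τ(j k) y = c(k) y` on `E`-fixed vectors, and **`E` fixes a non-zero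
vector of `W`**. Proof: a non-zero finite-dimensional `τ(j i₀ K₀)`-stable subspace of `W`
(`exists_finiteDimensional_invariant_of_compactSpace` with
`separatesPoints_translationFiniteSubalgebra_of_totallyDisconnectedSpace`), its `K`-saturation
(`exists_finiteDimensional_invariant_of_finset`, the centre acting on `W` by scalars,
`ClosedSubrep.exists_apply_eq_smul_of_mem_center`), and
`exists_minimalIdempotent_of_finiteDimensional_invariant`.
[cite: Gelbart1975, §10, pp. 151–153] -/
theorem ClosedSubrep.exists_minimalIdempotent_of_compactModCenter {τ : ContRepresentation ℂ Γ H}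
    (hτ : τ.IsUnitary) {W : ClosedSubrep τ} (hW : W.toContRep.IsTopIrreducible)
    (j : K →* Γ) (i₀ : K₀ →* K) (hc₀ : (τ.restrict (j.comp i₀)).IsStronglyContinuous)
    (μ : Measure K₀) [IsFiniteMeasureOnCompacts μ] [μ.IsOpenPosMeasure] [μ.IsMulLeftInvariant]
    (Z : Set K) (hZ : ∀ z ∈ Z, j z ∈ Subgroup.center Γ) (T : Finset K) (hT : T.Nonempty)
    (hdec : ∀ k : K, ∀ t ∈ T, ∃ t' ∈ T, ∃ k₀ : K₀, ∃ z ∈ Z, k * t = t' * i₀ k₀ * z) :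
    ∃ (E : H →L[ℂ] H) (c : K → ℂ),
      (∀ x y : H, ⟪E x, y⟫_ℂ = ⟪x, E y⟫_ℂ) ∧ (∀ x, E (E x) = E x) ∧
      (∀ A : H →L[ℂ] H, (∀ γ : Γ, A ∘L τ γ = τ γ ∘L A) → A ∘L E = E ∘L A) ∧
      (∀ γ : Γ, (∀ k : K, γ * j k = j k * γ) → ∀ y, E (τ γ y) = τ γ (E y)) ∧
      (∀ (k : K) (y : H), E y = y → E (τ (j k) y) = c k • y) ∧
      ∃ x ∈ W, x ≠ 0 ∧ E x = x := by
  -- a non-zero finite-dimensional `K₀`-stable subspace of `W`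
  have hW0 : W.toSubmodule ≠ ⊥ :=
    Submodule.nontrivial_iff_ne_bot.1 ((ContRepresentation.isTopIrreducible_iff _).1 hW).1
  obtain ⟨V₀, hV₀fd, hV₀W, hV₀0, hV₀inv⟩ :=
    Literature.NumberTheory.Automorphic.exists_finiteDimensional_invariant_of_compactSpace
      (τ.restrict (j.comp i₀)) hc₀ μ
      Literature.NumberTheory.Automorphic.separatesPoints_translationFiniteSubalgebra_of_totallyDisconnectedSpace
      W.toSubmodule W.isClosed (fun k₀ w hw => W.apply_mem (j (i₀ k₀)) hw) hW0
  haveI := hV₀fd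
  have hV₀inv' : ∀ k₀ ∈ Set.range i₀, ∀ v ∈ V₀, τ (j k₀) v ∈ V₀ := by
    rintro _ ⟨k₀, rfl⟩ v hv
    exact hV₀inv k₀ v hv
  -- central elements act on `W` by scalars, so `K · T ⊆ T · i₀(K₀)` up to scalars on `W`
  have hdec' : ∀ k : K, ∀ t ∈ T, ∃ t' ∈ T, ∃ k₀ ∈ Set.range i₀, ∃ c : ℂ, ∀ w ∈ W.toSubmodule,
      τ (j (k * t)) w = c • τ (j (t' * k₀)) w := by
    intro k t ht
    obtain ⟨t', ht', k₀, z, hz, hkt⟩ := hdec k t ht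
    obtain ⟨c, hc⟩ := ClosedSubrep.exists_apply_eq_smul_of_mem_center hτ hW (hZ z hz)
    refine ⟨t', ht', i₀ k₀, ⟨k₀, rfl⟩, c, fun w hw => ?_⟩
    have e : τ (j (k * t)) w = τ (j (t' * i₀ k₀)) (τ (j z) w) := by
      rw [hkt, map_mul j (t' * i₀ k₀) z, map_mul τ]
      rfl
    rw [e, hc w hw, map_smul]
  obtain ⟨V, hVfd, hVW, hV0, hVinv⟩ := exists_finiteDimensional_invariant_of_finset τ j
    W.toSubmodule (fun k w hw => W.apply_mem (j k) hw) (Set.range i₀) T hT hdec' V₀ hV₀W hV₀0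
    hV₀inv'
  haveI := hVfd
  obtain ⟨E, c, h1, h2, h3, h4, h5, x, hxV, hx0, hEx⟩ :=
    exists_minimalIdempotent_of_finiteDimensional_invariant τ hτ j V hV0 hVinv
  exact ⟨E, c, h1, h2, h3, h4, h5, x, hVW hxV, hx0, hEx⟩

end CompactModCenter

end ContRepresentation
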